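import Summits.BirchSwinnertonDyer.BirchSwinnertonDyer.Theorems.QuadraticBranchSignedControlPlusMainConjectureBranchSeams
import HarnessLib

/-!
# Route `QuadraticBranchSignedControl` (rung K8, cell `bsd-potss`), crux `PlusLowerInclusionSurjBranch`
# (item stmt-BirchSwinnertonDyer-19242, the Eisenstein half (E⁺) of (C1_η)): the DECOMPOSITION LEMMA
# (any dual datum of `Sel⁺(V'/F_∞)` is `Λ`-isomorphic to `X⁺(V/ℚ_∞) × X⁺(V/K_∞)^η`, granted the
# descent frame) and the UNIT ROWS of the crux (where (E⁺) is automatic)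

WHAT.
* §1 `exists_etaDatum_prod_linearEquiv_of_decomposition` — the reusable form of the `Λ`-algebra of
  `QuadraticBranchSignedControlPlusMainConjectureBranchSeams` §2 / `…PlusKatoDivisibilityOfEta`: GRANTED
  the prime-to-`p` descent frame at `(V, p, K₀, ηq)` (∀-form, displayed; the cell's WANTED piece (i)),
  for every admissible quadratic model `(F, V', κF, γF)` of (C1_η) and EVERY pair of dual data `D` (of
  `Sel⁺(V/ℚ_∞)` at `γ`) and `DF` (of `Sel⁺(V'/F_∞)` at `γF`) there are a generator `γ' ∈ Gal(ℚ̄/K₀)`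
  with `κ γ' = κ γ` (still matching the cyclotomic variable), an `η`-component datum `Dη` at `γ'`, and a
  `Λ`-LINEAR ISOMORPHISM `DF.X ≃ₗ[Λ] D.X × Dη.X`. (Product datum on `D.X × Dη.X` + uniqueness of signed
  dual data; no main conjecture, no Thm. 1.2/2.2 needed.) Every seam theorem of this seat is this lemma
  + multiplicativity of `Char`.
* §2 THE UNIT ROWS OF 19242: if the branch function `L_p⁺(V, η, X)` is a UNIT of `Λ` (`μ = λ = 0`;
  equivalently its constant term (3.6) `−(p/τ(η))·L(V, η̄, 1)/Ω_V^δ` is a `p`-adic unit, i.e. — by the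
  cell's value identity — `ord_p(L(W,1)/Ω_W) = 0` for the additive twist `W`: the rank-`0` rows with
  `p ∤ #Ш_an(W)·Tam(W)`, census-decidable), then the Eisenstein inclusion (E⁺)
  `Char X⁺(V/F_∞) ⊆ Char X⁺(V/ℚ_∞)·(Lη) = Char X⁺(V/ℚ_∞)` is AUTOMATIC from the decomposition
  (`Char DF = Char D · Char Dη ⊆ Char D`), granted Thm. 1.2 (NAMED fact, for `D`) and Thm. 2.2 at `η`
  (VERBATIM on the `η`-object, displayed, for `Dη`) which make `Char` multiplicative. So the HARD CORE
  of crux 19242 is {`r_an(W) ≥ 1`} ∪ {`r_an(W) = 0`, `p ∣ #Ш_an(W)·Tam(W)`} — the non-unit rows; on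
  the unit rows nothing beyond the frame and the two finiteness theorems is needed (and there
  `BSD(W,p)` is Kato's unit case anyway: no new closure is claimed, only the anatomy of the crux).

HONEST FRAMING (cell `bsd-potss`, run/shared/lean/pub/bsd-potss/; FULL-BSD rank ≤ 1 programme): TOOL
THEOREMS ONLY — no definition, no named fact minted, no `sorry`, axioms standard. CONDITIONAL on the
displayed frame `hdec`, the displayed Thm. 2.2-at-`η` reading, the displayed unit hypothesis and the
named fact `h12`; the crux / item / route are NOT closed; nothing is booked; `BSD(W, p)` is claimed for
no pair; this is not "finishing BSD". Seat `bsd-potss-k8q-c2` (prover), g0;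
`--supports stmt-BirchSwinnertonDyer-19242` (helper).

References: [Kobayashi2003] Thm. 1.2 (p. 2), Def. 2.1 + Thm. 2.2 (p. 5), §3 (p. 5), (3.6) (p. 7), §4
(p. 8); [GreenbergLNM1716] §1 (p. 60), §3; [Washington1997] §13.2.
-/

set_option autoImplicit false
set_option linter.dupNamespace false

noncomputable section

open scoped Classical

open CongruenceSubgroup Field WeierstrassCurve
open Literature.NumberTheory.EllipticCurves
open Literature.NumberTheory.EllipticCurves.ModularForms
open Literature.NumberTheory.EllipticCurves.Kobayashi2003 hiding EtaSignedSelmerDualData towerSignedSelmerInftyEta towerTopSubgroup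
  IsQuadraticBranchPlusLFunction
open Literature.NumberTheory.GaloisRepresentations
open Summit.BirchSwinnertonDyer.Rank1Residual.Additive
open Summit.BirchSwinnertonDyer.Rank1Residual.Additive.SignedTwist
open Summit.BirchSwinnertonDyer.BirchSwinnertonDyer.Theses.QuadraticBranchSignedControl

namespace Summit.BirchSwinnertonDyer.BirchSwinnertonDyer.Theorems

/-! ## §1 The decomposition lemma -/

/-- **Decomposition lemma**: granted the ∀-form descent frame at `(V, p, K₀, ηq)` (displayed; WANTED),
for every admissible quadratic model `(F, V', κF, γF)` and every dual data `D` of `Sel⁺(V/ℚ_∞)` at a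
generator `γ` matching the variable and `DF` of `Sel⁺(V'/F_∞)` at `γF`, there are `γ' ∈ Gal(ℚ̄/K₀)`,
a generator with `κ γ' = κ γ` matching the variable, an `η`-component dual datum `Dη` at `γ'`, and a
`Λ`-linear isomorphism `DF.X ≃ₗ[Λ] D.X × Dη.X` (the product datum built on `D.X × Dη.X` through the
frame's `Φ` — `conj_{γ'} = conj_γ` on `H¹(ℚ_∞, V[p^∞])` since `γ⁻¹γ'` acts trivially — compared with
`DF` by uniqueness of signed dual data). Pure transport; no main conjecture, no finiteness theorem.
[cite: Kobayashi2003, Def. 2.1 (p. 5), §3 (p. 5), §4 (p. 8; the η-component object)]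
[cite: GreenbergLNM1716, §1 (p. 60) and §3 (descent in prime-to-p extensions; reading)] -/
theorem exists_etaDatum_prod_linearEquiv_of_decomposition
    {V : WeierstrassCurve ℚ} [V.IsElliptic] [V.IsGloballyMinimal] {p : ℕ} [Fact p.Prime]
    (K₀ : Type) [Field K₀] [NumberField K₀] [IsCyclotomicExtension {p} ℚ K₀]
    [(galRange (K := ℚ) K₀).Normal] (ηq : absoluteGaloisGroup ℚ →* ℤˣ)
    (hdec : ∀ (κ : ZpExtension ℚ p) (γ : absoluteGaloisGroup ℚ),
        κ.IsCyclotomic → κ.IsTopGenerator γ → γ ∈ galRange (K := ℚ) K₀ →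
        IsCyclotomicVariable p γ →
      ∀ (F : Type) [Field F] [NumberField F] (V' : WeierstrassCurve F) [V'.IsElliptic]
        (κF : ZpExtension F p) (γF : absoluteGaloisGroup F),
        Module.finrank ℚ F = 2 → (∃ θ : F, θ ^ 2 = algebraMap ℚ F ((-1) ^ (p / 2) * p)) →
        (∃ C : VariableChange F, C • V.baseChange F = V') →
        κF.IsCyclotomic → κF.IsTopGenerator γF →
        (∃ ζ : ℤ_[p]ˣ, IsOfFinOrder ζ ∧
          ((GaloisRep.cyclotomicCharacter F p γF * ζ : ℤ_[p]ˣ) : ℤ_[p]) =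
            (cyclotomicGenerator p : ℤ_[p])) →
      ∃ Φ : signedSelmerInfty V' κF 1 ≃+
          signedSelmerInfty V κ 1 × towerSignedSelmerInftyEta V κ K₀ ℚ_[p] ηq 1,
        ∀ s : signedSelmerInfty V' κF 1,
          ((Φ ⟨V'.conjH1 p κF.kerSubgroup γF s,
              conjH1_mem_signedSelmerInfty V' κF 1 γF s.2⟩).1 : V.subgroupH1 p κ.kerSubgroup) =
            V.conjH1 p κ.kerSubgroup γ (Φ s).1 ∧
          ((Φ ⟨V'.conjH1 p κF.kerSubgroup γF s,
              conjH1_mem_signedSelmerInfty V' κF 1 γF s.2⟩).2 :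
              V.subgroupH1 p (towerTopSubgroup κ K₀)) =
            V.conjH1 p (towerTopSubgroup κ K₀) γ (Φ s).2)
    (F : Type) [Field F] [NumberField F] (V' : WeierstrassCurve F) [V'.IsElliptic]
    {κ : ZpExtension ℚ p} {γ : absoluteGaloisGroup ℚ}
    {κF : ZpExtension F p} {γF : absoluteGaloisGroup F}
    (hF : Module.finrank ℚ F = 2) (hθ : ∃ θ : F, θ ^ 2 = algebraMap ℚ F ((-1) ^ (p / 2) * p))
    (hC : ∃ C : VariableChange F, C • V.baseChange F = V')
    (hκ : κ.IsCyclotomic) (hγ : κ.IsTopGenerator γ) (hγc : IsCyclotomicVariable p γ)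
    (hκF : κF.IsCyclotomic) (hγF : κF.IsTopGenerator γF)
    (hζ : ∃ ζ : ℤ_[p]ˣ, IsOfFinOrder ζ ∧
      ((GaloisRep.cyclotomicCharacter F p γF * ζ : ℤ_[p]ˣ) : ℤ_[p]) =
        (cyclotomicGenerator p : ℤ_[p]))
    (D : SignedSelmerDualData V κ γ 1) (DF : SignedSelmerDualData V' κF γF 1) :
    ∃ (γ' : absoluteGaloisGroup ℚ) (_ : γ' ∈ galRange (K := ℚ) K₀) (_ : κ.IsTopGenerator γ')
      (_ : IsCyclotomicVariable p γ') (Dη : EtaSignedSelmerDualData V κ K₀ ℚ_[p] ηq γ' 1),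
      Nonempty (DF.X ≃ₗ[IwasawaAlgebra p] (D.X × Dη.X)) := by
  -- move `γ` inside `Gal(ℚ̄/K₀)` keeping `κ γ`
  have hκ₀ := kappa_surjOn_galRange_cyclotomic κ K₀
  obtain ⟨γ', hγ'K, hγ'κ⟩ := hκ₀ (κ γ)
  have hγγ' : γ⁻¹ * γ' ∈ κ.kerSubgroup := by
    rw [ZpExtension.mem_kerSubgroup, map_mul, map_inv, hγ'κ, inv_mul_cancel]
  have hγ' : κ.IsTopGenerator γ' := by rw [ZpExtension.IsTopGenerator, hγ'κ]; exact hγ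
  have hγ'c : IsCyclotomicVariable p γ' := isCyclotomicVariable_of_inv_mul_mem_ker hκ hγγ' hγc
  -- `conj_{γ'} = conj_γ` on `H¹(ℚ_∞, V[p^∞])`
  have hconj : ∀ s : V.subgroupH1 p κ.kerSubgroup,
      V.conjH1 p κ.kerSubgroup γ' s = V.conjH1 p κ.kerSubgroup γ s := by
    intro s
    have hmul := V.conjH1_mul_holds p κ.kerSubgroup γ (γ⁻¹ * γ')
    rw [mul_inv_cancel_left] at hmul
    rw [hmul, AddMonoidHom.comp_apply, V.conjH1_of_mem_holds p κ.kerSubgroup hγγ',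
      AddMonoidHom.id_apply]
  -- the frame and an `η`-datum at `γ'`
  obtain ⟨Φ, hΦ⟩ := hdec κ γ' hκ hγ' hγ'K hγ'c F V' κF γF hF hθ hC hκF hγF hζ
  obtain ⟨Dη⟩ := nonempty_etaSignedSelmerDualData V κ K₀ ℚ_[p] ηq 1 hκ₀ hγ' hγ'K
  -- the character group of the direct sum and the product datum at `γF`
  let π₀ : signedSelmerInfty V' κF 1 →+ signedSelmerInfty V κ 1 :=
    (AddMonoidHom.fst _ _).comp Φ.toAddMonoidHom
  let π₁ : signedSelmerInfty V' κF 1 →+ towerSignedSelmerInftyEta V κ K₀ ℚ_[p] ηq 1 :=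
    (AddMonoidHom.snd _ _).comp Φ.toAddMonoidHom
  let T : D.X × Dη.X →+ (signedSelmerInfty V' κF 1 →+ AddCircle (1 : ℚ)) :=
    AddMonoidHom.mk' (fun x => (D.toDual x.1).comp π₀ + (Dη.toDual x.2).comp π₁) (by
      intro x y
      simp only [Prod.fst_add, Prod.snd_add, map_add, AddMonoidHom.add_comp]
      abel)
  have hT : ∀ (x : D.X × Dη.X) (s : signedSelmerInfty V' κF 1),
      T x s = D.toDual x.1 (Φ s).1 + Dη.toDual x.2 (Φ s).2 := fun x s => rfl
  have hTbij : Function.Bijective T :=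
    bijective_dualOfProd Φ D.toDual Dη.toDual D.bijective Dη.bijective
  let DF' : SignedSelmerDualData V' κF γF 1 :=
    { X := D.X × Dη.X
      conj_mem := fun s hs => conjH1_mem_signedSelmerInfty V' κF 1 γF hs
      toDual := T
      bijective := hTbij
      toDual_T_smul := by
        intro x s
        have h0 : (Φ ⟨V'.conjH1 p κF.kerSubgroup γF s,
            conjH1_mem_signedSelmerInfty V' κF 1 γF s.2⟩).1 =
            ⟨V.conjH1 p κ.kerSubgroup γ (Φ s).1, D.conj_mem _ (Φ s).1.2⟩ :=
          Subtype.ext (by rw [(hΦ s).1, hconj])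
        have h1 : (Φ ⟨V'.conjH1 p κF.kerSubgroup γF s,
            conjH1_mem_signedSelmerInfty V' κF 1 γF s.2⟩).2 =
            ⟨V.conjH1 p (towerTopSubgroup κ K₀) γ' (Φ s).2, Dη.conj_mem _ (Φ s).2.2⟩ :=
          Subtype.ext (hΦ s).2
        rw [hT, hT, hT, Prod.smul_fst, Prod.smul_snd, D.toDual_T_smul, Dη.toDual_T_smul, h0, h1]
        abel
      toDual_C_smul := by
        intro c x s k hk
        have hk' : (p ^ k) • Φ s = 0 := by rw [← map_nsmul, hk, map_zero]
        have hk0 : (p ^ k) • (Φ s).1 = 0 := by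
          have h := congrArg Prod.fst hk'
          rwa [Prod.smul_fst, Prod.fst_zero] at h
        have hk1 : (p ^ k) • (Φ s).2 = 0 := by
          have h := congrArg Prod.snd hk'
          rwa [Prod.smul_snd, Prod.snd_zero] at h
        rw [hT, hT, Prod.smul_fst, Prod.smul_snd, D.toDual_C_smul c x.1 _ k hk0,
          Dη.toDual_C_smul c x.2 _ k hk1, smul_add] }
  -- uniqueness of signed dual data
  obtain ⟨e, -⟩ := SignedSelmerDualData.exists_linearEquiv DF DF'
  exact ⟨γ', hγ'K, hγ', hγ'c, Dη, ⟨e⟩⟩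

/-! ## §2 The unit rows of crux 19242 -/

/-- **(E⁺) AT A PAIR on a UNIT ROW, from the decomposition** (abstract cyclotomic model `K₀`). IF
(`h12`) Kobayashi's Thm. 1.2 (NAMED fact: `X⁺(V/ℚ_∞)` finitely generated `Λ`-torsion), (`hdec`) the
∀-form descent frame at `(V, p, K₀, ηq)` (WANTED, displayed), (`h22η`) Thm. 2.2 at `η` VERBATIM on the
`η`-component object ("`X^±(E/K_∞)^η` is a [finitely generated] torsion `ℤ_p[[Γ]]`-module", p. 8 —
displayed), and (`hunit`) EVERY function with the interpolation property of `L_p⁺(V, η, X)` attached to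
the newform of `V` and the period ratio of the parity of `η` is a UNIT of `Λ` (they differ by units,
so this says: `L_p⁺(V, η, X) ∈ Λ^×`, i.e. `μ = λ = 0` — census-decidable; displayed), THEN
`QuadraticBranchPlusLowerInclusionAt V p`: `Char DF = Char D · Char Dη ⊆ Char D = Char D · (Lη)`.
CONDITIONAL; closes nothing; no `BSD(W,p)` claimed (these are Kato's unit rows anyway).
[cite: Kobayashi2003, Thm. 1.2 (p. 2), Thm. 2.2 (p. 5), (3.6) (p. 7), §4 (p. 8)]
[cite: Washington1997, §13.2 (characteristic ideals over Λ)] -/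
theorem quadraticBranchPlusLowerInclusionAt_of_isUnit_of_decomposition
    {V : WeierstrassCurve ℚ} [V.IsElliptic] [V.IsGloballyMinimal] {p : ℕ} [Fact p.Prime]
    (h12 : thm12_signedSelmerDual_finite_torsion)
    (K₀ : Type) [Field K₀] [NumberField K₀] [IsCyclotomicExtension {p} ℚ K₀]
    [(galRange (K := ℚ) K₀).Normal] (ηq : absoluteGaloisGroup ℚ →* ℤˣ)
    (hdec : ∀ (κ : ZpExtension ℚ p) (γ : absoluteGaloisGroup ℚ),
        κ.IsCyclotomic → κ.IsTopGenerator γ → γ ∈ galRange (K := ℚ) K₀ →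
        IsCyclotomicVariable p γ →
      ∀ (F : Type) [Field F] [NumberField F] (V' : WeierstrassCurve F) [V'.IsElliptic]
        (κF : ZpExtension F p) (γF : absoluteGaloisGroup F),
        Module.finrank ℚ F = 2 → (∃ θ : F, θ ^ 2 = algebraMap ℚ F ((-1) ^ (p / 2) * p)) →
        (∃ C : VariableChange F, C • V.baseChange F = V') →
        κF.IsCyclotomic → κF.IsTopGenerator γF →
        (∃ ζ : ℤ_[p]ˣ, IsOfFinOrder ζ ∧
          ((GaloisRep.cyclotomicCharacter F p γF * ζ : ℤ_[p]ˣ) : ℤ_[p]) =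
            (cyclotomicGenerator p : ℤ_[p])) →
      ∃ Φ : signedSelmerInfty V' κF 1 ≃+
          signedSelmerInfty V κ 1 × towerSignedSelmerInftyEta V κ K₀ ℚ_[p] ηq 1,
        ∀ s : signedSelmerInfty V' κF 1,
          ((Φ ⟨V'.conjH1 p κF.kerSubgroup γF s,
              conjH1_mem_signedSelmerInfty V' κF 1 γF s.2⟩).1 : V.subgroupH1 p κ.kerSubgroup) =
            V.conjH1 p κ.kerSubgroup γ (Φ s).1 ∧
          ((Φ ⟨V'.conjH1 p κF.kerSubgroup γF s,
              conjH1_mem_signedSelmerInfty V' κF 1 γF s.2⟩).2 :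
              V.subgroupH1 p (towerTopSubgroup κ K₀)) =
            V.conjH1 p (towerTopSubgroup κ K₀) γ (Φ s).2)
    (h22η : ∀ (κ : ZpExtension ℚ p) (γ : absoluteGaloisGroup ℚ),
        κ.IsCyclotomic → κ.IsTopGenerator γ → γ ∈ galRange (K := ℚ) K₀ →
      ∀ (D : EtaSignedSelmerDualData V κ K₀ ℚ_[p] ηq γ 1),
        Module.Finite (IwasawaAlgebra p) D.X ∧ Module.IsTorsion (IwasawaAlgebra p) D.X)
    (hunit : ∀ {N : ℕ} [NeZero N] {f : CuspForm (Gamma0 N) 2}, IsNewformOf V f →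
      ∀ (ϖ : ℚ), (if Even (p / 2) then (ϖ : ℝ) * V.realPeriodRat = plusPeriod f
          else (ϖ : ℝ) * V.imaginaryPeriodRat = minusPeriod f) →
      ∀ (Lη : IwasawaAlgebra p), IsQuadraticBranchPlusLFunction f p ϖ Lη → IsUnit Lη) :
    QuadraticBranchPlusLowerInclusionAt V p := by
  intro F _ _ V' _ κ γ κF γF N _ f hp2 hgood hap hF hθ hC hκ hγ hγc hκF hγF hζ hf ϖ hϖ Lη hL D DF
  obtain ⟨γ', hγ'K, hγ', -, Dη, ⟨e⟩⟩ :=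
    exists_etaDatum_prod_linearEquiv_of_decomposition K₀ ηq hdec F V' hF hθ hC hκ hγ hγc hκF hγF hζ
      D DF
  -- finiteness: Thm. 1.2 for `D`, Thm. 2.2 at `η` for `Dη`
  obtain ⟨hDfin, hDtor⟩ := h12 V p hp2 hgood hap κ γ hκ hγ 1 D
  obtain ⟨hηfin, hηtor⟩ := h22η κ γ' hκ hγ' hγ'K Dη
  haveI : Module.Finite (IwasawaAlgebra p) D.X := hDfin
  haveI : Module.Finite (IwasawaAlgebra p) Dη.X := hηfin
  have hPtor : Module.IsTorsion (IwasawaAlgebra p) (D.X × Dη.X) :=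
    isTorsion_prod_of_isTorsion hDtor hηtor
  have hPchar : Module.charIdeal (IwasawaAlgebra p) (D.X × Dη.X) =
      Module.charIdeal (IwasawaAlgebra p) D.X * Module.charIdeal (IwasawaAlgebra p) Dη.X :=
    charIdeal_mul_of_shortExact_holds p (D.X × Dη.X) hPtor
      (LinearMap.inl (IwasawaAlgebra p) D.X Dη.X) (LinearMap.snd (IwasawaAlgebra p) D.X Dη.X)
      LinearMap.inl_injective LinearMap.snd_surjective .inl_snd
  -- `(Lη) = Λ` on a unit row
  have hspan : Ideal.span {Lη} = ⊤ := Ideal.span_singleton_eq_top.mpr (hunit hf ϖ hϖ Lη hL)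
  change Module.charIdeal (IwasawaAlgebra p) DF.X ≤
    Module.charIdeal (IwasawaAlgebra p) D.X * Ideal.span {Lη}
  rw [hspan, Ideal.mul_top, Module.charIdeal_eq_of_linearEquiv e, hPchar]
  exact Ideal.mul_le_right

/-- **The unit rows of crux `PlusLowerInclusionSurjBranch` (item 19242), route-level form.** GRANTED
Thm. 1.2 (NAMED fact), the ∀-form descent frame `hdec` and Thm. 2.2 at `η` verbatim on the `η`-object
`h22η` (both displayed, quantified over `p ≥ 5`, cyclotomic `K₀`, quadratic `ηq`, good `a_p = 0` twists
`V`), the crux holds on every row whose branch function `L_p⁺(V, η, X)` is a unit of `Λ` (displayed per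
pair as the extra antecedent; the tower-surjectivity antecedent of the crux is not used). Hence the
non-unit rows — `r_an(W) ≥ 1`, or `r_an(W) = 0` with `p ∣ #Ш_an(W)·Tam(W)`, `W = V ⊗ χ_{p*}` — are the
whole content of 19242. `K₀ := ℚ(ζ_p)`, `η` from `exists_theta_eta_cyclotomicField`. CONDITIONAL;
closes nothing. [cite: Kobayashi2003, Thm. 1.2 (p. 2), Thm. 2.2 (p. 5), (3.6) (p. 7), §4 (p. 8)] -/
theorem plusLowerInclusionSurj_on_unitRows_of_decomposition
    (h12 : thm12_signedSelmerDual_finite_torsion)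
    (hdec : ∀ (p : ℕ) [Fact p.Prime], 5 ≤ p →
      ∀ (K₀ : Type) [Field K₀] [NumberField K₀] [IsCyclotomicExtension {p} ℚ K₀]
        [(galRange (K := ℚ) K₀).Normal] (ηq : absoluteGaloisGroup ℚ →* ℤˣ),
        (∀ σ ∈ galRange (K := ℚ) K₀, ηq σ = 1) → ηq ≠ 1 →
      ∀ (V : WeierstrassCurve ℚ) [V.IsElliptic] [V.IsGloballyMinimal],
        V.HasGoodReductionAtPrime p → V.frobeniusTrace p = 0 →
      ∀ (κ : ZpExtension ℚ p) (γ : absoluteGaloisGroup ℚ),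
        κ.IsCyclotomic → κ.IsTopGenerator γ → γ ∈ galRange (K := ℚ) K₀ →
        IsCyclotomicVariable p γ →
      ∀ (F : Type) [Field F] [NumberField F] (V' : WeierstrassCurve F) [V'.IsElliptic]
        (κF : ZpExtension F p) (γF : absoluteGaloisGroup F),
        Module.finrank ℚ F = 2 → (∃ θ : F, θ ^ 2 = algebraMap ℚ F ((-1) ^ (p / 2) * p)) →
        (∃ C : VariableChange F, C • V.baseChange F = V') →
        κF.IsCyclotomic → κF.IsTopGenerator γF →
        (∃ ζ : ℤ_[p]ˣ, IsOfFinOrder ζ ∧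
          ((GaloisRep.cyclotomicCharacter F p γF * ζ : ℤ_[p]ˣ) : ℤ_[p]) =
            (cyclotomicGenerator p : ℤ_[p])) →
      ∃ Φ : signedSelmerInfty V' κF 1 ≃+
          signedSelmerInfty V κ 1 × towerSignedSelmerInftyEta V κ K₀ ℚ_[p] ηq 1,
        ∀ s : signedSelmerInfty V' κF 1,
          ((Φ ⟨V'.conjH1 p κF.kerSubgroup γF s,
              conjH1_mem_signedSelmerInfty V' κF 1 γF s.2⟩).1 : V.subgroupH1 p κ.kerSubgroup) =
            V.conjH1 p κ.kerSubgroup γ (Φ s).1 ∧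
          ((Φ ⟨V'.conjH1 p κF.kerSubgroup γF s,
              conjH1_mem_signedSelmerInfty V' κF 1 γF s.2⟩).2 :
              V.subgroupH1 p (towerTopSubgroup κ K₀)) =
            V.conjH1 p (towerTopSubgroup κ K₀) γ (Φ s).2)
    (h22η : ∀ (p : ℕ) [Fact p.Prime], 5 ≤ p →
      ∀ (K₀ : Type) [Field K₀] [NumberField K₀] [IsCyclotomicExtension {p} ℚ K₀]
        [(galRange (K := ℚ) K₀).Normal] (ηq : absoluteGaloisGroup ℚ →* ℤˣ),
        (∀ σ ∈ galRange (K := ℚ) K₀, ηq σ = 1) → ηq ≠ 1 →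
      ∀ (V : WeierstrassCurve ℚ) [V.IsElliptic] [V.IsGloballyMinimal],
        p ≠ 2 → V.HasGoodReductionAtPrime p → V.frobeniusTrace p = 0 →
      ∀ (κ : ZpExtension ℚ p) (γ : absoluteGaloisGroup ℚ),
        κ.IsCyclotomic → κ.IsTopGenerator γ → γ ∈ galRange (K := ℚ) K₀ →
      ∀ (D : EtaSignedSelmerDualData V κ K₀ ℚ_[p] ηq γ 1),
        Module.Finite (IwasawaAlgebra p) D.X ∧ Module.IsTorsion (IwasawaAlgebra p) D.X) :
    ∀ (V : WeierstrassCurve ℚ) [V.IsElliptic] [V.IsGloballyMinimal] (p : ℕ) [Fact p.Prime],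
      5 ≤ p → V.HasGoodReductionAtPrime p → V.frobeniusTrace p = 0 →
      (∀ m : ℕ, V.HasSurjectiveModNGaloisRep (p ^ m : ℕ)) →
      (∀ {N : ℕ} [NeZero N] {f : CuspForm (Gamma0 N) 2}, IsNewformOf V f →
        ∀ (ϖ : ℚ), (if Even (p / 2) then (ϖ : ℝ) * V.realPeriodRat = plusPeriod f
            else (ϖ : ℝ) * V.imaginaryPeriodRat = minusPeriod f) →
        ∀ (Lη : IwasawaAlgebra p), IsQuadraticBranchPlusLFunction f p ϖ Lη → IsUnit Lη) →
      QuadraticBranchPlusLowerInclusionAt V p := by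
  intro V _ _ p _ hp5 hgood hap _ hunit
  have hp2 : p ≠ 2 := by omega
  haveI : NeZero p := ⟨(Fact.out : p.Prime).ne_zero⟩
  haveI : IsCyclotomicExtension {p} ℚ (CyclotomicField p ℚ) :=
    CyclotomicField.isCyclotomicExtension p ℚ
  haveI : (galRange (K := ℚ) (CyclotomicField p ℚ)).Normal := normal_galRange_cyclotomic p _
  obtain ⟨θ, ηq, -, -, -, hηK, hη1⟩ := exists_theta_eta_cyclotomicField p hp2
  exact quadraticBranchPlusLowerInclusionAt_of_isUnit_of_decomposition h12 (CyclotomicField p ℚ) ηq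
    (fun κ γ hκ hγ hγK hγc F _ _ V' _ κF γF hF hθ hC hκF hγF hζ =>
      hdec p hp5 (CyclotomicField p ℚ) ηq hηK hη1 V hgood hap κ γ hκ hγ hγK hγc F V' κF γF hF hθ hC
        hκF hγF hζ)
    (fun κ γ hκ hγ hγK Dη => h22η p hp5 (CyclotomicField p ℚ) ηq hηK hη1 V hp2 hgood hap κ γ hκ hγ
      hγK Dη)
    (fun hf ϖ hϖ Lη hL => hunit hf ϖ hϖ Lη hL)

end Summit.BirchSwinnertonDyer.BirchSwinnertonDyer.Theorems

end
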